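import Summits.Ventures.HodgeRepro2.T5SchurMathlib
import Summits.Ventures.HodgeRepro2.T5AveragedProjection

/-!
# Complete reducibility in Mathlib's vocabulary: `IsSemisimpleRepresentation` / `IsSemisimpleModule`

Blind cell `pub-hodge-repro2`, seat p1 (gen 12), Tier-5 kernel support for the representation-theoretic
sentences of `route/T5-SUPPORT-p1.md` §S4.7.

`T5AveragedProjection.exists_isCompl_isStable` gives every `π`-stable subspace of a continuous
finite-dimensional representation `π` of a compact group a `π`-stable complement.  Mathlib's notion of a
completely reducible representation is `Representation.IsSemisimpleRepresentation ρ :=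
ComplementedLattice (Subrepresentation ρ)` («every subrepresentation has a complement»), equivalent to
`IsSemisimpleModule (MonoidAlgebra k G) ρ.asModule`
(`Representation.isSemisimpleRepresentation_iff_isSemisimpleModule_asModule`).  This file transports
the stable complement along `T5SchurMathlib.toRep π : Representation ℂ G V`:

* `isStable_toSubmodule` — the underlying submodule of a subrepresentation of `toRep π` is `π`-stable;
* `isCompl_iff_toSubmodule` — complements in the lattice `Subrepresentation (toRep π)` are complements
  of the underlying submodules (the lattice structure is transported along the injective
  `toSubmodule`);
* `isSemisimpleRepresentation_toRep` — **`(toRep π).IsSemisimpleRepresentation`** for every continuous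
  finite-dimensional `π` of a compact group (no unitarity);
* `isSemisimpleModule_asModule` — **`IsSemisimpleModule (MonoidAlgebra ℂ G) (toRep π).asModule`**.

Honest scope (unchanged from the Schur group): compact groups and finite-dimensional representations
only; nothing about U(1,1), its discrete series, or (N).
-/

namespace Summit.Ventures.HodgeRepro2.T5SemisimpleBridge

open MeasureTheory T5SchurOrthogonality T5CompleteReducibility T5SchurMathlib

section lattice

variable {G : Type*} [Group G]
variable {V : Type*} [NormedAddCommGroup V] [InnerProductSpace ℂ V]
variable (π : G →* V →L[ℂ] V)

/-- The underlying submodule of a subrepresentation of `toRep π` is `π`-stable. -/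
theorem isStable_toSubmodule (A : Subrepresentation (toRep π)) : IsStable π A.toSubmodule :=
  fun g _ hx => A.apply_mem_toSubmodule g hx

/-- `toSubmodule` of the bottom subrepresentation is `⊥`. -/
theorem toSubmodule_bot : (⊥ : Subrepresentation (toRep π)).toSubmodule = ⊥ := rfl

/-- `toSubmodule` of the top subrepresentation is `⊤`. -/
theorem toSubmodule_top : (⊤ : Subrepresentation (toRep π)).toSubmodule = ⊤ := rfl

/-- Two subrepresentations of `toRep π` are complementary iff their underlying submodules are. -/
theorem isCompl_iff_toSubmodule (A B : Subrepresentation (toRep π)) :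
    IsCompl A B ↔ IsCompl A.toSubmodule B.toSubmodule := by
  rw [isCompl_iff, isCompl_iff, disjoint_iff, disjoint_iff, codisjoint_iff, codisjoint_iff,
    ← Subrepresentation.toSubmodule_inf, ← Subrepresentation.toSubmodule_sup, ← toSubmodule_bot π,
    ← toSubmodule_top π, Subrepresentation.toSubmodule_injective.eq_iff,
    Subrepresentation.toSubmodule_injective.eq_iff]

end lattice

section semisimple

variable {G : Type*} [Group G] [TopologicalSpace G] [IsTopologicalGroup G]
  [MeasurableSpace G] [BorelSpace G] [CompactSpace G]
variable {V : Type*} [NormedAddCommGroup V] [InnerProductSpace ℂ V] [FiniteDimensional ℂ V]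
variable (μ : Measure G) [IsProbabilityMeasure μ] [μ.IsMulLeftInvariant]
variable (π : G →* V →L[ℂ] V)

include μ in
/-- Every subrepresentation of `toRep π` has a complementary subrepresentation: the stable complement
of `T5AveragedProjection`, packaged by `T5SchurMathlib.subrepOfStable`. -/
theorem exists_isCompl_subrep (hπ : Continuous π) (A : Subrepresentation (toRep π)) :
    ∃ B : Subrepresentation (toRep π), IsCompl A B := by
  obtain ⟨C, hC, hAC⟩ :=
    T5AveragedProjection.exists_isCompl_isStable μ π hπ (isStable_toSubmodule π A)
  exact ⟨subrepOfStable π C hC, (isCompl_iff_toSubmodule π A _).mpr hAC⟩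

include μ in
/-- **Complete reducibility in Mathlib's vocabulary**: for a continuous finite-dimensional
representation `π` of a compact group, `toRep π` is a semisimple representation —
`ComplementedLattice (Subrepresentation (toRep π))`. No unitarity is assumed. -/
theorem isSemisimpleRepresentation_toRep (hπ : Continuous π) :
    (toRep π).IsSemisimpleRepresentation :=
  ⟨exists_isCompl_subrep μ π hπ⟩

include μ in
/-- The module form: `(toRep π).asModule` is a semisimple `MonoidAlgebra ℂ G`-module. -/
theorem isSemisimpleModule_asModule (hπ : Continuous π) :
    IsSemisimpleModule (MonoidAlgebra ℂ G) (toRep π).asModule :=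
  (Representation.isSemisimpleRepresentation_iff_isSemisimpleModule_asModule _).mp
    (isSemisimpleRepresentation_toRep μ π hπ)

/-- The same with the normalised Haar measure of the compact Hausdorff group `G`: no measure in the
statement. -/
theorem isSemisimpleRepresentation_toRep_of_compact [T2Space G] (hπ : Continuous π) :
    (toRep π).IsSemisimpleRepresentation :=
  isSemisimpleRepresentation_toRep (haarProb G) π hπ

/-- The module form with the normalised Haar measure. -/
theorem isSemisimpleModule_asModule_of_compact [T2Space G] (hπ : Continuous π) :
    IsSemisimpleModule (MonoidAlgebra ℂ G) (toRep π).asModule :=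
  isSemisimpleModule_asModule (haarProb G) π hπ

end semisimple

end Summit.Ventures.HodgeRepro2.T5SemisimpleBridge
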